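import Summits.QuantumFields.YangMills.Theorems.AllWindowsColdBoxTiltedCovPrelims
import HarnessLib

/-!
# Second-order expansion of a tilted covariance in Hölder norms
# (registered stub A `stub_tiltedCovSecondOrder : TiltedCovSecondOrder` of LINE-17 «hypercontractive second-order tilt
# expansion» on crux `AllWindowsColdBox.BoxMidWindowsSU22`, stmt-QuantumFields-24003; also the A-component of the shared
# obligation S2 of LINE-18 on stmt-QuantumFields-24006)

For a probability measure `ν`, a centred tilt `V` with `∫ V⁸ dν ≤ 1` and `e^{4|V|} ∈ L¹(ν)`, and observables `f, g ∈ L⁴(ν)`,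
the covariance under the exponentially tilted measure `ν.tilted V` (density `e^V / ∫ e^V dν`) satisfies
`|Cov_{ν.tilted V}(f,g) − Cov_ν(f,g) − ∫ f̃ g̃ V dν| ≤ 4 ‖f̃‖₄ ‖g̃‖₄ (∫V⁸)^{1/4} (∫ e^{4|V|})^{1/2}`, `f̃ = f − ∫ f dν`.

Proof (elementary): `Z = ∫ e^V ≥ 1` (`e^t ≥ 1 + t`, `∫ V = 0`); `e^V = 1 + V + R` with `0 ≤ R ≤ ½ V² e^{|V|}`
(`exp_sub_one_sub_le`, by one monotonicity argument on each half-line); all tilted integrals are `(∫ · e^V dν)/Z`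
(`MeasureTheory.integral_tilted`); the covariance is reduced to the centred observables; every remainder is bounded by the
squared Cauchy–Schwarz inequality `(∫ φψ)² ≤ ∫ φ² ∫ ψ²` and `(∫ h)² ≤ ∫ h²`, and the resulting polynomial inequality in
`‖f̃‖₄, ‖g̃‖₄, (∫V⁸)^{1/4} ≤ 1 ≤ (∫e^{4|V|})^{1/4}` has constant `15/4 ≤ 4`.  Mathlib only.

HONEST LABEL: an abstract measure-theory lemma; it closes ONE registered M-stub of two lines on the R2ξ″ RECORD-rung cruxes
24003/24006; no crux, rung or summit is proved; the Yang–Mills mass gap is NOT proved by this file.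
-/

set_option autoImplicit false

noncomputable section

open MeasureTheory

namespace Summit.QuantumFields.YangMills.Theorems.AllWindowsColdBoxTiltedCov

/-! ## 1. The centred estimate -/

/-- **The tilted covariance to second order, centred form.**  `F, G` centred in `L⁴(ν)`, `V` centred with `∫V⁸ ≤ 1` and
`e^{4|V|} ∈ L¹`, `a, b` constants; the covariance of `F + a, G + b` under `ν.tilted V` minus the `ν`-covariance minus the
first-order term `∫ F G V` is at most `4 ‖F‖₄ ‖G‖₄ (∫V⁸)^{1/4} (∫e^{4|V|})^{1/2}`. -/
theorem tiltedCov_secondOrder_centred {Ω : Type*} [MeasurableSpace Ω] (ν : Measure Ω) [IsProbabilityMeasure ν]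
    (F G V : Ω → ℝ) (a b : ℝ) (hFm : Measurable F) (hGm : Measurable G) (hVm : Measurable V)
    (hF0 : ∫ ω, F ω ∂ν = 0) (hG0 : ∫ ω, G ω ∂ν = 0) (hV0 : ∫ ω, V ω ∂ν = 0)
    (hexp : Integrable (fun ω => Real.exp (4 * |V ω|)) ν)
    (hV8 : MemLp V 8 ν) (hF4 : MemLp F 4 ν) (hG4 : MemLp G 4 ν) (hV8le : ∫ ω, V ω ^ 8 ∂ν ≤ 1) :
    |((∫ ω, (F ω + a) * (G ω + b) ∂ν.tilted V) -
          (∫ ω, (F ω + a) ∂ν.tilted V) * (∫ ω, (G ω + b) ∂ν.tilted V)) -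
        ((∫ ω, (F ω + a) * (G ω + b) ∂ν) - a * b) - ∫ ω, F ω * G ω * V ω ∂ν| ≤
      4 * (∫ ω, F ω ^ 4 ∂ν) ^ (1 / 4 : ℝ) * (∫ ω, G ω ^ 4 ∂ν) ^ (1 / 4 : ℝ) *
        (∫ ω, V ω ^ 8 ∂ν) ^ (1 / 4 : ℝ) * (∫ ω, Real.exp (4 * |V ω|) ∂ν) ^ (1 / 2 : ℝ) := by
  /- 0. Integrability toolkit. -/
  have n4 : ∀ y : ℝ, ‖y‖ ^ 4 = y ^ 4 := fun y => by
    rw [Real.norm_eq_abs, ← abs_pow, abs_of_nonneg (by positivity)]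
  have n8 : ∀ y : ℝ, ‖y‖ ^ 8 = y ^ 8 := fun y => by
    rw [Real.norm_eq_abs, ← abs_pow, abs_of_nonneg (by positivity)]
  have iF4 : Integrable (fun ω => F ω ^ 4) ν := by
    simpa only [n4] using hF4.integrable_norm_pow (by norm_num)
  have iG4 : Integrable (fun ω => G ω ^ 4) ν := by
    simpa only [n4] using hG4.integrable_norm_pow (by norm_num)
  have iV8 : Integrable (fun ω => V ω ^ 8) ν := by
    simpa only [n8] using hV8.integrable_norm_pow (by norm_num)
  have hV4 : MemLp V 4 ν := hV8.mono_exponent (by norm_num)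
  have iV4 : Integrable (fun ω => V ω ^ 4) ν := by
    simpa only [n4] using hV4.integrable_norm_pow (by norm_num)
  have hF2 : MemLp F 2 ν := hF4.mono_exponent (by norm_num)
  have hG2 : MemLp G 2 ν := hG4.mono_exponent (by norm_num)
  have hV2 : MemLp V 2 ν := hV8.mono_exponent (by norm_num)
  have iF2 : Integrable (fun ω => F ω ^ 2) ν := hF2.integrable_sq
  have iG2 : Integrable (fun ω => G ω ^ 2) ν := hG2.integrable_sq
  have iV2 : Integrable (fun ω => V ω ^ 2) ν := hV2.integrable_sq
  have iF : Integrable F ν := hF4.integrable (by norm_num)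
  have iG : Integrable G ν := hG4.integrable (by norm_num)
  have iV : Integrable V ν := hV8.integrable (by norm_num)
  have mF2 : MemLp (fun ω => F ω ^ 2) 2 ν :=
    memLp_two_of_sq_eq (hFm.pow_const 2).aestronglyMeasurable iF4 (fun ω => by ring)
  have mG2 : MemLp (fun ω => G ω ^ 2) 2 ν :=
    memLp_two_of_sq_eq (hGm.pow_const 2).aestronglyMeasurable iG4 (fun ω => by ring)
  have mV4 : MemLp (fun ω => V ω ^ 4) 2 ν :=
    memLp_two_of_sq_eq (hVm.pow_const 4).aestronglyMeasurable iV8 (fun ω => by ring)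
  have iF2G2 : Integrable (fun ω => F ω ^ 2 * G ω ^ 2) ν := integrable_mul_of_memLp_two mF2 mG2
  have mFG : MemLp (fun ω => F ω * G ω) 2 ν :=
    memLp_two_of_sq_eq (hFm.mul hGm).aestronglyMeasurable iF2G2 (fun ω => by ring)
  have iFG : Integrable (fun ω => F ω * G ω) ν := integrable_mul_of_memLp_two hF2 hG2
  have iFGV : Integrable (fun ω => F ω * G ω * V ω) ν := integrable_mul_of_memLp_two mFG hV2
  have iFV : Integrable (fun ω => F ω * V ω) ν := integrable_mul_of_memLp_two hF2 hV2
  have iGV : Integrable (fun ω => G ω * V ω) ν := integrable_mul_of_memLp_two hG2 hV2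
  -- the exponential weights `e^{|V|}`, `e^{V}` and the remainder majorant `Q = V² e^{|V|}`
  have hE1m : Measurable fun ω => Real.exp |V ω| :=
    Real.continuous_exp.measurable.comp (continuous_abs.measurable.comp hVm)
  have hexpm : Measurable fun ω => Real.exp (V ω) := Real.continuous_exp.measurable.comp hVm
  have hE1sq : ∀ ω, (Real.exp |V ω| ^ 2) ^ 2 = Real.exp (4 * |V ω|) := fun ω => by
    rw [← pow_mul, ← Real.exp_nat_mul]; norm_num
  have iE1_4 : Integrable (fun ω => (Real.exp |V ω| ^ 2) ^ 2) ν := by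
    simpa only [hE1sq] using hexp
  have mE1sq : MemLp (fun ω => Real.exp |V ω| ^ 2) 2 ν :=
    memLp_two_of_sq_eq (hE1m.pow_const 2).aestronglyMeasurable iE1_4 (fun ω => rfl)
  have iexp2 : Integrable (fun ω => Real.exp (V ω) ^ 2) ν := by
    refine hexp.mono' (hexpm.pow_const 2).aestronglyMeasurable (ae_of_all _ fun ω => ?_)
    rw [Real.norm_eq_abs, abs_of_nonneg (by positivity), ← Real.exp_nat_mul]
    refine Real.exp_le_exp.2 ?_
    have h1 := le_abs_self (V ω)
    have h2 := abs_nonneg (V ω)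
    push_cast
    linarith
  have mexp : MemLp (fun ω => Real.exp (V ω)) 2 ν :=
    memLp_two_of_sq_eq hexpm.aestronglyMeasurable iexp2 (fun ω => rfl)
  have iexp : Integrable (fun ω => Real.exp (V ω)) ν := mexp.integrable (by norm_num)
  have hQm : Measurable fun ω => V ω ^ 2 * Real.exp |V ω| := (hVm.pow_const 2).mul hE1m
  have iQ2 : Integrable (fun ω => V ω ^ 4 * Real.exp |V ω| ^ 2) ν := integrable_mul_of_memLp_two mV4 mE1sq
  have mQ : MemLp (fun ω => V ω ^ 2 * Real.exp |V ω|) 2 ν :=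
    memLp_two_of_sq_eq hQm.aestronglyMeasurable iQ2 (fun ω => by ring)
  have iQ : Integrable (fun ω => V ω ^ 2 * Real.exp |V ω|) ν := mQ.integrable (by norm_num)
  have iEFG : Integrable (fun ω => Real.exp (V ω) * (F ω * G ω)) ν := integrable_mul_of_memLp_two mexp mFG
  have iEF : Integrable (fun ω => Real.exp (V ω) * F ω) ν := integrable_mul_of_memLp_two mexp hF2
  have iEG : Integrable (fun ω => Real.exp (V ω) * G ω) ν := integrable_mul_of_memLp_two mexp hG2
  have iFGQ : Integrable (fun ω => |F ω * G ω| * (V ω ^ 2 * Real.exp |V ω|)) ν :=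
    integrable_mul_of_memLp_two mFG.norm mQ
  have iFQ : Integrable (fun ω => |F ω| * (V ω ^ 2 * Real.exp |V ω|)) ν :=
    integrable_mul_of_memLp_two hF2.norm mQ
  have iGQ : Integrable (fun ω => |G ω| * (V ω ^ 2 * Real.exp |V ω|)) ν :=
    integrable_mul_of_memLp_two hG2.norm mQ
  have iE1' : Integrable (fun ω => Real.exp (V ω) - 1) ν := iexp.sub (integrable_const _)
  have iR : Integrable (fun ω => Real.exp (V ω) - 1 - V ω) ν := iE1'.sub iV
  have iRFG : Integrable (fun ω => (Real.exp (V ω) - 1 - V ω) * (F ω * G ω)) ν :=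
    ((iEFG.sub iFG).sub iFGV).congr (ae_of_all _ fun ω => by simp only [Pi.sub_apply]; ring)
  have iRF : Integrable (fun ω => (Real.exp (V ω) - 1 - V ω) * F ω) ν :=
    ((iEF.sub iF).sub iFV).congr (ae_of_all _ fun ω => by simp only [Pi.sub_apply]; ring)
  have iRG : Integrable (fun ω => (Real.exp (V ω) - 1 - V ω) * G ω) ν :=
    ((iEG.sub iG).sub iGV).congr (ae_of_all _ fun ω => by simp only [Pi.sub_apply]; ring)
  /- 1. The partition function and the tilted integrals. -/
  set Z : ℝ := ∫ ω, Real.exp (V ω) ∂ν with hZ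
  have hT : ∀ h : Ω → ℝ, ∫ ω, h ω ∂ν.tilted V = (∫ ω, Real.exp (V ω) * h ω ∂ν) / Z := by
    intro h
    rw [integral_tilted, ← hZ, ← integral_div]
    refine integral_congr_ae (ae_of_all _ fun ω => ?_)
    simp only [smul_eq_mul]
    ring
  have hZ1 : Z = 1 + ∫ ω, (Real.exp (V ω) - 1 - V ω) ∂ν := by
    rw [integral_sub iE1' iV, integral_sub iexp (integrable_const _), hV0]
    simp [hZ]
  have hρ0_nn : 0 ≤ ∫ ω, (Real.exp (V ω) - 1 - V ω) ∂ν := integral_nonneg fun ω => exp_sub_one_sub_nonneg (V ω)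
  have hρ0_le : ∫ ω, (Real.exp (V ω) - 1 - V ω) ∂ν ≤ 1 / 2 * ∫ ω, V ω ^ 2 * Real.exp |V ω| ∂ν := by
    rw [← integral_const_mul]
    exact integral_mono iR (iQ.const_mul _) fun ω => by
      have := exp_sub_one_sub_le (V ω); simp only; linarith
  have hZ_one : 1 ≤ Z := by linarith
  have hZq : Z - 1 ≤ 1 / 2 * ∫ ω, V ω ^ 2 * Real.exp |V ω| ∂ν := by linarith
  /- 2. Second-order expansion of the three weighted integrals. -/
  have hEFG : ∫ ω, Real.exp (V ω) * (F ω * G ω) ∂ν = (∫ ω, F ω * G ω ∂ν) + (∫ ω, F ω * G ω * V ω ∂ν) +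
      ∫ ω, (Real.exp (V ω) - 1 - V ω) * (F ω * G ω) ∂ν := by
    have e : ∀ ω, Real.exp (V ω) * (F ω * G ω) =
        (F ω * G ω + F ω * G ω * V ω) + (Real.exp (V ω) - 1 - V ω) * (F ω * G ω) := fun ω => by ring
    have i1 : Integrable (fun ω => F ω * G ω + F ω * G ω * V ω) ν := iFG.add iFGV
    simp_rw [e]
    rw [integral_add i1 iRFG, integral_add iFG iFGV]
  have hEF : ∫ ω, Real.exp (V ω) * F ω ∂ν = (∫ ω, F ω * V ω ∂ν) + ∫ ω, (Real.exp (V ω) - 1 - V ω) * F ω ∂ν := by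
    have e : ∀ ω, Real.exp (V ω) * F ω =
        (F ω + F ω * V ω) + (Real.exp (V ω) - 1 - V ω) * F ω := fun ω => by ring
    have i1 : Integrable (fun ω => F ω + F ω * V ω) ν := iF.add iFV
    simp_rw [e]
    rw [integral_add i1 iRF, integral_add iF iFV, hF0, zero_add]
  have hEG : ∫ ω, Real.exp (V ω) * G ω ∂ν = (∫ ω, G ω * V ω ∂ν) + ∫ ω, (Real.exp (V ω) - 1 - V ω) * G ω ∂ν := by
    have e : ∀ ω, Real.exp (V ω) * G ω =
        (G ω + G ω * V ω) + (Real.exp (V ω) - 1 - V ω) * G ω := fun ω => by ring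
    have i1 : Integrable (fun ω => G ω + G ω * V ω) ν := iG.add iGV
    simp_rw [e]
    rw [integral_add i1 iRG, integral_add iG iGV, hG0, zero_add]
  have hνfg : ∫ ω, (F ω + a) * (G ω + b) ∂ν = (∫ ω, F ω * G ω ∂ν) + a * b := by
    have e : ∀ ω, (F ω + a) * (G ω + b) = F ω * G ω + a * G ω + b * F ω + a * b := fun ω => by ring
    have i1 : Integrable (fun ω => F ω * G ω + a * G ω) ν := iFG.add (iG.const_mul a)
    have i2 : Integrable (fun ω => F ω * G ω + a * G ω + b * F ω) ν := i1.add (iF.const_mul b)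
    simp_rw [e]
    rw [integral_add i2 (integrable_const _), integral_add i1 (iF.const_mul b), integral_add iFG (iG.const_mul a),
      integral_const_mul, integral_const_mul, hF0, hG0]
    simp
  set νFG : ℝ := ∫ ω, F ω * G ω ∂ν with hνFG
  set I3 : ℝ := ∫ ω, F ω * G ω * V ω ∂ν with hI3
  set fv : ℝ := ∫ ω, F ω * V ω ∂ν with hfv
  set gv : ℝ := ∫ ω, G ω * V ω ∂ν with hgv
  set ρFG : ℝ := ∫ ω, (Real.exp (V ω) - 1 - V ω) * (F ω * G ω) ∂ν with hρFG
  set ρF : ℝ := ∫ ω, (Real.exp (V ω) - 1 - V ω) * F ω ∂ν with hρF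
  set ρG : ℝ := ∫ ω, (Real.exp (V ω) - 1 - V ω) * G ω ∂ν with hρG
  -- the tilted integrals of the shifted observables
  have hTfg : ∫ ω, (F ω + a) * (G ω + b) ∂ν.tilted V =
      (νFG + I3 + ρFG + a * (gv + ρG) + b * (fv + ρF) + a * b * Z) / Z := by
    rw [hT]
    have e : ∀ ω, Real.exp (V ω) * ((F ω + a) * (G ω + b)) = Real.exp (V ω) * (F ω * G ω) +
        a * (Real.exp (V ω) * G ω) + b * (Real.exp (V ω) * F ω) + a * b * Real.exp (V ω) := fun ω => by ring
    have i1 : Integrable (fun ω => Real.exp (V ω) * (F ω * G ω) + a * (Real.exp (V ω) * G ω)) ν :=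
      iEFG.add (iEG.const_mul a)
    have i2 : Integrable (fun ω => Real.exp (V ω) * (F ω * G ω) + a * (Real.exp (V ω) * G ω) +
        b * (Real.exp (V ω) * F ω)) ν := i1.add (iEF.const_mul b)
    simp_rw [e]
    rw [integral_add i2 (iexp.const_mul _), integral_add i1 (iEF.const_mul b),
      integral_add iEFG (iEG.const_mul a), integral_const_mul, integral_const_mul, integral_const_mul,
      hEFG, hEF, hEG]
  have hTf : ∫ ω, (F ω + a) ∂ν.tilted V = (fv + ρF + a * Z) / Z := by
    rw [hT]
    have e : ∀ ω, Real.exp (V ω) * (F ω + a) = Real.exp (V ω) * F ω + a * Real.exp (V ω) := fun ω => by ring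
    simp_rw [e]
    rw [integral_add iEF (iexp.const_mul a), integral_const_mul, hEF]
  have hTg : ∫ ω, (G ω + b) ∂ν.tilted V = (gv + ρG + b * Z) / Z := by
    rw [hT]
    have e : ∀ ω, Real.exp (V ω) * (G ω + b) = Real.exp (V ω) * G ω + b * Real.exp (V ω) := fun ω => by ring
    simp_rw [e]
    rw [integral_add iEG (iexp.const_mul b), integral_const_mul, hEG]
  /- 3. The algebraic identity. -/
  have hLHS : ((∫ ω, (F ω + a) * (G ω + b) ∂ν.tilted V) -
          (∫ ω, (F ω + a) ∂ν.tilted V) * (∫ ω, (G ω + b) ∂ν.tilted V)) -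
        ((∫ ω, (F ω + a) * (G ω + b) ∂ν) - a * b) - I3 =
      (νFG + I3) * (1 / Z - 1) + ρFG / Z - (fv + ρF) * (gv + ρG) / Z ^ 2 := by
    rw [hTfg, hTf, hTg, hνfg]
    field_simp
    ring
  rw [hLHS]
  refine (abs_expansion_le _ _ _ _ hZ_one).trans ?_
  /- 4. The remainders are dominated by the majorant `Q`. -/
  have hρFG_le : |ρFG| ≤ 1 / 2 * ∫ ω, |F ω * G ω| * (V ω ^ 2 * Real.exp |V ω|) ∂ν := by
    rw [← integral_const_mul]
    exact (abs_integral_le_integral_abs).trans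
      (integral_mono iRFG.abs (iFGQ.const_mul _) fun ω => abs_expRem_mul_le _ _)
  have hρF_le : |ρF| ≤ 1 / 2 * ∫ ω, |F ω| * (V ω ^ 2 * Real.exp |V ω|) ∂ν := by
    rw [← integral_const_mul]
    exact (abs_integral_le_integral_abs).trans
      (integral_mono iRF.abs (iFQ.const_mul _) fun ω => abs_expRem_mul_le _ _)
  have hρG_le : |ρG| ≤ 1 / 2 * ∫ ω, |G ω| * (V ω ^ 2 * Real.exp |V ω|) ∂ν := by
    rw [← integral_const_mul]
    exact (abs_integral_le_integral_abs).trans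
      (integral_mono iRG.abs (iGQ.const_mul _) fun ω => abs_expRem_mul_le _ _)
  /- 5. Cauchy–Schwarz and bookkeeping. -/
  have hX1 : 1 ≤ ∫ ω, Real.exp (4 * |V ω|) ∂ν := by
    have h1 : ∫ _ω, (1 : ℝ) ∂ν ≤ ∫ ω, Real.exp (4 * |V ω|) ∂ν :=
      integral_mono (integrable_const _) hexp fun ω => Real.one_le_exp (by positivity)
    have h2 : ∫ _ω, (1 : ℝ) ∂ν = 1 := by simp
    linarith
  exact tiltedCov_bookkeeping
    (integral_nonneg fun ω => by positivity) (integral_nonneg fun ω => by positivity)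
    (integral_nonneg fun ω => by positivity) hV8le hX1
    (integral_nonneg fun ω => by positivity) (integral_nonneg fun ω => by positivity)
    (integral_nonneg fun ω => by positivity) (integral_nonneg fun ω => by positivity)
    (sq_integral_mul_le (fun _ => rfl) (fun _ => rfl) iF2 iG2 iFG)
    (sq_integral_le (fun ω => by ring) iF2 iF4)
    (sq_integral_le (fun ω => by ring) iG2 iG4)
    (sq_integral_mul_le (φ := fun ω => F ω * G ω) (fun ω => by ring) (fun _ => rfl) iF2G2 iV2 iFGV)
    (sq_integral_mul_le (φ := fun ω => F ω ^ 2) (ψ := fun ω => G ω ^ 2) (fun ω => by ring) (fun ω => by ring)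
      iF4 iG4 iF2G2)
    (sq_integral_le (fun ω => by ring) iV2 iV4)
    (sq_integral_le (fun ω => by ring) iV4 iV8)
    (sq_integral_le (fun ω => by ring) iQ iQ2)
    (sq_integral_mul_le (φ := fun ω => V ω ^ 4) (ψ := fun ω => Real.exp |V ω| ^ 2) (fun ω => by ring) hE1sq
      iV8 hexp iQ2)
    (sq_integral_mul_le (φ := fun ω => |F ω * G ω|) (ψ := fun ω => V ω ^ 2 * Real.exp |V ω|)
      (fun ω => by rw [sq_abs]; ring) (fun ω => by ring) iF2G2 iQ2 iFGQ)
    (sq_integral_mul_le (fun _ => rfl) (fun _ => rfl) iF2 iV2 iFV)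
    (sq_integral_mul_le (fun _ => rfl) (fun _ => rfl) iG2 iV2 iGV)
    (sq_integral_mul_le (φ := fun ω => |F ω|) (ψ := fun ω => V ω ^ 2 * Real.exp |V ω|)
      (fun ω => by rw [sq_abs]) (fun ω => by ring) iF2 iQ2 iFQ)
    (sq_integral_mul_le (φ := fun ω => |G ω|) (ψ := fun ω => V ω ^ 2 * Real.exp |V ω|)
      (fun ω => by rw [sq_abs]) (fun ω => by ring) iG2 iQ2 iGQ)
    hZ_one hZq hρFG_le hρF_le hρG_le

/-! ## 2. The registered stub -/

/-- The registered stub statement `TiltedCovSecondOrder` of LINE-17 (skeleton v3, sha16 4747b363) on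
`AllWindowsColdBox.BoxMidWindowsSU22` (stmt-QuantumFields-24003), verbatim; registered-stub copy, not a citable fact. -/
abbrev TiltedCovSecondOrder : Prop :=
  ∀ (Ω : Type) [MeasurableSpace Ω] (ν : Measure Ω) [IsProbabilityMeasure ν] (V f g : Ω → ℝ),
    Measurable V → Measurable f → Measurable g →
    ∫ ω, V ω ∂ν = 0 →
    Integrable (fun ω => Real.exp (4 * |V ω|)) ν →
    MemLp V 8 ν → MemLp f 4 ν → MemLp g 4 ν →
    ∫ ω, V ω ^ 8 ∂ν ≤ 1 →
    |((∫ ω, f ω * g ω ∂ν.tilted V) - (∫ ω, f ω ∂ν.tilted V) * (∫ ω, g ω ∂ν.tilted V)) -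
        ((∫ ω, f ω * g ω ∂ν) - (∫ ω, f ω ∂ν) * (∫ ω, g ω ∂ν)) -
        ∫ ω, (f ω - ∫ x, f x ∂ν) * (g ω - ∫ x, g x ∂ν) * V ω ∂ν| ≤
      4 * (∫ ω, (f ω - ∫ x, f x ∂ν) ^ 4 ∂ν) ^ (1 / 4 : ℝ) * (∫ ω, (g ω - ∫ x, g x ∂ν) ^ 4 ∂ν) ^ (1 / 4 : ℝ) *
        (∫ ω, V ω ^ 8 ∂ν) ^ (1 / 4 : ℝ) * (∫ ω, Real.exp (4 * |V ω|) ∂ν) ^ (1 / 2 : ℝ)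

/-- **STUB A of LINE-17 «hypercontractive second-order tilt expansion» (stmt-QuantumFields-24003), by name and signature:**
the second-order expansion of a tilted covariance in Hölder norms (reduce to the centred observables `f − ∫f`, `g − ∫g`
and apply `tiltedCov_secondOrder_centred`). -/
theorem stub_tiltedCovSecondOrder : TiltedCovSecondOrder := by
  intro Ω _ ν _ V f g hVm hfm hgm hV0 hexp hV8 hf4 hg4 hV8le
  set a : ℝ := ∫ x, f x ∂ν with ha
  set b : ℝ := ∫ x, g x ∂ν with hb
  have iF : Integrable f ν := hf4.integrable (by norm_num)
  have iG : Integrable g ν := hg4.integrable (by norm_num)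
  have hF0 : ∫ ω, (f ω - a) ∂ν = 0 := by
    rw [integral_sub iF (integrable_const a)]; simp [ha]
  have hG0 : ∫ ω, (g ω - b) ∂ν = 0 := by
    rw [integral_sub iG (integrable_const b)]; simp [hb]
  have hF4 : MemLp (fun ω => f ω - a) 4 ν := hf4.sub (memLp_const a)
  have hG4 : MemLp (fun ω => g ω - b) 4 ν := hg4.sub (memLp_const b)
  have h := tiltedCov_secondOrder_centred ν (fun ω => f ω - a) (fun ω => g ω - b) V a b
    (hfm.sub measurable_const) (hgm.sub measurable_const) hVm hF0 hG0 hV0 hexp hV8 hF4 hG4 hV8le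
  simp only [sub_add_cancel] at h
  exact h

end Summit.QuantumFields.YangMills.Theorems.AllWindowsColdBoxTiltedCov

end
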